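import Summits.QuantumFields.QCD.Theorems.LightQuarkCompletion.Negative.Anatomy

/-!
# Crux `LightQuarkCompletion` (stmt-QuantumFields-18066, route NestedDissectionSea, rank 6), negative side —
# the crux is a self-improvement statement of its own hypothesis package

Support file of the standing disprover (cycle 2, refuter-cdisprove-stmt-QuantumFields-18066-g2-0, 2026-08-17; extract of
`Cruxes/LightQuarkCompletion/Disproof.lean` §9).  NO refutation.  Sorry-free, standard axioms, no definition; nothing asserts a
Theses decl (the decl appears only inside an `↔`, as in `Anatomy.lean`).

`Concl Nf` (the crux's `reg`-free conclusion, `Anatomy.lean`) is itself an instance of the hypothesis package `HypAt` at threshold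
`0` — the weak branch `∀ᶠ k, −1 ≤ m_crit' k` follows from `m_crit' → 0` — so the crux reads: "if `HypAt` is inhabited at SOME
threshold `M₀`, it is inhabited at threshold `0` by a regularisation that is moreover on the physical branch and chiral at zero"
(`lightQuarkCompletion_iff_selfImprovement`).  Consequently the hypotheses act only as an EXISTENCE ASSUMPTION: the whole content
is the passage `M₀ ↦ 0` + branch + chirality, and `Concl 2 ∧ Concl 3` implies the crux outright (recorded in `Disproof.lean` as
`lightQuarkCompletion_of_concl`; not landed here because its conclusion is the Theses decl).
-/

noncomputable section

open scoped BigOperators Classical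
open MeasureTheory Filter Topology Matrix
open Literature.MathematicalPhysics.QuantumLattice Literature.MathematicalPhysics.QuantumFieldTheory
  Literature.Probability.LatticeModels
open Summit.QuantumFields.QCD.Theses.NestedDissectionSea
open Summit.QuantumFields.QCD.Theorems.CoerciveSeaNegative
open Summit.QuantumFields.QCD.Theorems.EarlyCrosserLawNegative

namespace Summit.QuantumFields.QCD.Theorems.LightQuarkCompletion.Negative

variable {Nf : ℕ}

/-- `Concl` inhabits the hypothesis package at threshold `0`, on the branch and chiral (the weak branch from `m_crit' → 0`).
[folklore] -/
theorem hypAt_zero_of_concl (h : Concl Nf) :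
    ∃ reg : QCDRegularisation Nf, HypAt Nf reg 0 ∧ Tendsto reg.mcrit atTop (𝓝 0) ∧ reg.IsChiralAtZero := by
  obtain ⟨reg', hMS, hAS, hlim, hpin, hχ, hbody⟩ := h
  have hbr : ∀ᶠ k : ℕ in atTop, -1 ≤ reg'.mcrit k := by
    filter_upwards [hlim.eventually (Ioi_mem_nhds (show (-1 : ℝ) < 0 by norm_num))] with k hk
    exact (Set.mem_Ioi.mp hk).le
  exact ⟨reg', ⟨hMS, hAS, hbr, le_rfl, hpin, hbody⟩, hlim, hχ⟩

/-- `Concl Nf` ⇔ the package is inhabited at threshold `0` by a branch regularisation chiral at zero. [folklore] -/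
theorem concl_iff_hypAt_zero :
    Concl Nf ↔ ∃ reg : QCDRegularisation Nf, HypAt Nf reg 0 ∧ Tendsto reg.mcrit atTop (𝓝 0) ∧ reg.IsChiralAtZero := by
  refine ⟨hypAt_zero_of_concl, ?_⟩
  rintro ⟨reg, ⟨hMS, hAS, -, -, hpin, hbody⟩, hlim, hχ⟩
  exact ⟨reg, hMS, hAS, hlim, hpin, hχ, hbody⟩

/-- **The crux as self-improvement of its own package**: inhabited at some threshold ⇒ inhabited at threshold `0`, on the
branch, chiral at zero. [folklore] -/
theorem lightQuarkCompletion_iff_selfImprovement :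
    LightQuarkCompletion ↔ ∀ Nf : ℕ, (Nf = 2 ∨ Nf = 3) → (∃ (reg : QCDRegularisation Nf) (M₀ : ℝ), HypAt Nf reg M₀) →
      ∃ reg : QCDRegularisation Nf, HypAt Nf reg 0 ∧ Tendsto reg.mcrit atTop (𝓝 0) ∧ reg.IsChiralAtZero := by
  rw [lightQuarkCompletion_iff_exists]
  refine forall_congr' fun Nf => forall_congr' fun _ => forall_congr' fun _ => ?_
  exact concl_iff_hypAt_zero

end Summit.QuantumFields.QCD.Theorems.LightQuarkCompletion.Negative

end
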